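import Summits.QuantumFields.BalabanUV.Beta.D1BFx.RoadEndBFxJunctionsWS
import Summits.QuantumFields.BalabanUV.Beta.D1BFx.PackedRoadRowsMassFlatRows
import Summits.QuantumFields.BalabanUV.Beta.D1BFx.RoadEndBFxRoadScalesMassS
import Summits.QuantumFields.BalabanUV.Beta.D1BFx.GhostQWordsScales

/-!
# `BalabanUV.Beta.D1BFx.RoadEndBFxRoadScalesWFlatS` — road «BF-x», row D1: **PART 22″ «THE HEAD WITH A GENERAL SECOND-ORDER SLOT AND NO (J1) ROW»** (an2 g58 RULING
# R-D1-g58-1 «SHAPE (A′): `RJ1 :≡ 0`; the literal's W slot is read IN FULL; its extra words join the END's model through the (J2) dictionary; GO for PART 22″»;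
# SPEC (J2)″ v1.1 `HOME/b2b-balaban-beta-an2/gen58/SPEC-J2pp-g58.v1_1.md` §4; the road's shape note `HOME/b2b-balaban-beta-d1-p2/g30/PART22pp-SHAPE-g30.md`).
# PART 21♭ `RoadEndBFxRoadScalesJ1RFlatS.d1Rep_BFx_road_scales_J1rest_flat_sbpS` (the road's head on the scales: flat [M] currency, (C1)(C2)(C3) discharged, (J3) in
# closed form with the GAP ROW, (J1) RESTED with rows `hMR₁ hC₁`) VERBATIM except: (i) the (J1) rest `RJ1` and its rows `{CJ1} hMR₁ hC₁` are GONE — `hJ1` is the identity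
# `TshotOf Lc Jc m μ ν z = hessKer (G₀ n) (vertexOfK (G₀ n) n (S n)) (W n) μ ν z` for a DISPLAYED general second-order family `W`; (ii) the (J2) dictionary `hJ2`
# books the road's packed pair PLUS the W-slot carry `½·tadpole (G₀ n) (W n μ 0 ν z) − ½·tadpole (G₀ n) (vertex2OfK (G₀ n) n (S₂ n) μ 0 ν z)` (the ONE changed
# hypothesis; the carry's content — W2″a's two mixed words + the typed-zero chain word + the pair slot's chart word — together with the first-order dictionary W1′ is what a supplier of `hJ2` meets (Q-DICT-N″); `RJ2` keeps `hMR₂ hC₂`).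
# Proof = PART 21♭'s body ending in PART 20″ `RoadEndBFxJunctionsWS.d1Rep_BFx_of_junctions_W_sbpS` on the rest family `RkRoad a r S S₂ RJ2 R3` (PART 17-M's glue).
HONEST DEPENDENCY (cell records, verbatim): «continuum YM on T⁴ ⇐ BetaPertH ∧ nine spine estimates (0/9 proved); BetaPertH ⇐ (D1) ∧ (D4) ∧
CAP+tail; G-an2-4 gates asym, D1 and NE2/3/4.»  HONEST FRAMING (cell contract, verbatim): «discharging `BetaPertH` makes Bałaban's UV stability
UNCONDITIONAL — a real constructive-QFT result; it is NOT the continuum limit and NOT the Clay problem.»  THIS MODULE DISCHARGES NOTHING of (K), of D1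
or of the wall: [folklore] composition BY NAME; every junction ∕ row ∕ socket DISPLAYED; removing the (J1) ROW discharges nothing — its content now sits in the
displayed dictionary `hJ2`.  No definition, no `def … : Prop`, nothing cited, 0 sorry.  0 root-level binders of row D1 discharged; (K) NOT closed; NOT D1, NEVER
«G-an2-4 closed», NOT `BetaPertH`, NOT continuum, NOT Clay.
ABSOLUTE RULE (cell charter, verbatim): «No internally-minted statement may enter as a cited fact. Every hypothesis is either kernel-proved in this
package or a verbatim quotation of a PUBLISHED theorem with page reference. The manuscript(s) under audit are NOT citable for their own disputed
steps — they are the thing under adjudication; programme-internal (2001/route/tribunal) claims are never citable.»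
CONTENT ([folklore]): **`d1Rep_BFx_road_scales_W_flat_sbpS`**.  Unit `b2b-balaban-beta-d1-p2` (owner, gen 31), 2026-08-25; generator `g31/gen/mk_f2.py` over PART 21♭'s tree bytes.
-/

noncomputable section
open Finset Filter Topology Matrix
open scoped BigOperators Kronecker
open Literature.MathematicalPhysics.QuantumFieldTheory.Balaban1983to89
open Literature.MathematicalPhysics.QuantumFieldTheory.Balaban1983to89.Beta
open OneStepResolventKernel (JetData KInv Fib wsum LocStencil)
open OneStepKernelFamily (TbalOf TshotOf flipK D1Tel D1Rep KInvStep colH vertexOfK)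
open PolarizationSign (WardTransversal AxisReflectionCovariant)
open InterLevelTransport (onLat)
open BalabanStepJets (lamCoeffOf)
open AveragingHessianKernels (hessFF)
open KernelWard (divV)
open B12Sec2to5 (l1)
open DyadicShell (supNorm)
open ExpKernelCalculus (Site MKer BiLoc shiftK comp hessKer tadpole bubble)
open DecimatedMomentSummable (AbsMoment₂)
open Summit.QuantumFields.BalabanUV.Beta.TameKernelCalculus (Loc trK)
open Summit.QuantumFields.BalabanUV.Beta.D1BFx.ReducedKernel (TableR TOfRed)
open Summit.QuantumFields.BalabanUV.Beta.D1BFx.DressedTadpoleTable (tableRed)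
open Summit.QuantumFields.BalabanUV.Beta.D1BFx.ReducedKernelSandwich (fineHess)
open Summit.QuantumFields.BalabanUV.Beta.D1BFx.FineStencilBF (ffOf)
open Summit.QuantumFields.BalabanUV.Beta.D1BFx.FineStencilBFBalaban (SbfBal)
open Summit.QuantumFields.BalabanUV.Beta.D1BFx.SecondStencilBF (Wbf)
open Summit.QuantumFields.BalabanUV.Beta.D1BFx.GhostKernelComplete (PghQ absMoment₂_PghQ)
open Summit.QuantumFields.BalabanUV.Beta.D1BFx.GluonLeg (Ga)
open Summit.QuantumFields.BalabanUV.Beta.D1BFx.FrozenLegTails (nOf MOf hn1)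
open VectorTailsLoc (fam kfam)
open Literature.MathematicalPhysics.QuantumFieldTheory.Balaban1983to89.Beta.Composition (kkt)
open Summit.QuantumFields.BalabanUV.Beta.AxialDressingRooted (coDressKBmAt coProjBmAtK)
open Summit.QuantumFields.BalabanUV.Beta.D1BFx.SortedKernels (fTL fBL)
open Summit.QuantumFields.BalabanUV.Beta.D1BFx.PackedNSideDictionary (SN)
open Summit.QuantumFields.BalabanUV.Beta.D1BFx.PackedNSidePair (W2NInf)
open AffineAveraging (box toSite)
open SecondOrderResponse (vertex2OfK)
open Summit.QuantumFields.BalabanUV.Beta.D1BFx.FibredPeriodisation (periodiseF)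
open Summit.QuantumFields.BalabanUV.Beta.D1BFx.SortedPack (sortK)
open Summit.QuantumFields.BalabanUV.Beta.D1BFx.SortedReblocking (torusBlockEquiv)
open Summit.QuantumFields.BalabanUV.Beta.D1BFx.SortedEmbedding (e₁)
open Summit.QuantumFields.BalabanUV.Beta.D1BFx.PeriodicArrays (arr)
open Summit.QuantumFields.BalabanUV.Beta.D1BFx.TorusCombKKT (I J CombRows Khat Qhat)
open Summit.QuantumFields.BalabanUV.Beta.D1BFx.TorusGaugeBasis (What0)
open Summit.QuantumFields.BalabanUV.Beta.D1BFx.TorusGaugeBasisMatrix (Nhat)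
open Summit.QuantumFields.BalabanUV.Beta.D1BFx.TorusCoframeJets (Djet)
open Summit.QuantumFields.BalabanUV.Beta.D1BFx.GhostStencil (ghCur)
open Summit.QuantumFields.BalabanUV.Beta.D1BFx.TorusGhostPairStencils (gh₂)
open Summit.QuantumFields.BalabanUV.Beta.D1BFx.WardJetsFromNoether (oslot)
open Summit.QuantumFields.BalabanUV.Beta.D1BFx.ColourLiftAdE3 (c₃)
open Summit.QuantumFields.BalabanUV.Beta.D1BFx.PackedKernelSplit (blk ffW)
open Summit.QuantumFields.BalabanUV.Beta.D1BFx.ReducedKernelF (TOfLeg)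
open Summit.QuantumFields.BalabanUV.Beta.D1BFx.GhostLeg (Ggh)
open Summit.QuantumFields.BalabanUV.Beta.D1BFx.RoadEndBFxJunctionsS (d1Rep_BFx_of_junctions_sbpS)
open Summit.QuantumFields.BalabanUV.Beta.D1BFx.PackedRoadRestFamily (RoadIdx RkRoad Vgh Wgh wroad_eq_dite sum_RkRoad_of_neZero)
open Summit.QuantumFields.BalabanUV.Beta.D1BFx.PackedRoadRowsMass (road_sand_rows_mass road_blk_rows_mass)
open Summit.QuantumFields.BalabanUV.Beta.D1BFx.PackedRoadRowsMassFlatRows (road_sand_rows_mass_tt road_blk_rows_mass_flat)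
open Summit.QuantumFields.BalabanUV.Beta.D1BFx.CoframeJetMassScales (exists_C1_letters)
open B5Hk163Strip (kappa163_pos kappa163)
open Summit.QuantumFields.BalabanUV.Beta.D1BFx.RestKernelGhostRoad (decay510_ghostWordK_road KG_road_nonneg kappaG_road_pos)
open Summit.QuantumFields.BalabanUV.Beta.D1BFx.RestKernelFPSlotRoad (END_rows_RkFP_road)
open Summit.QuantumFields.BalabanUV.Beta.D1BFx.RestKernelGhostSlotJ (END_rows_RkGhJ)
open Summit.QuantumFields.BalabanUV.Beta.D1BFx.RestKernelSlotGlue (hMR_elim hRu_elim_zero)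
open Summit.QuantumFields.BalabanUV.Beta.D1BFx.GhostStencilRooted (qAntiAt)
open Summit.QuantumFields.BalabanUV.Beta.D1BFx.GhostStencilRootedReflection (ctrHalf)
open Summit.QuantumFields.BalabanUV.Beta.D1BFx.GhostAveragingSquare (qSqAt)
open Summit.QuantumFields.BalabanUV.Beta.D1BFx.GhostDeficitFormula (J3_closed_form)
open Summit.QuantumFields.BalabanUV.Beta.D1BFx.RoadEndBFxRoadScalesJ3S (absMoment₂_lin abs_secondMoment_lin_le)
open Summit.QuantumFields.BalabanUV.Beta.D1BFx.CoframeTableMassScales (exists_C2_letters)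
open Summit.QuantumFields.BalabanUV.Beta.D1BFx.GhostQWordsScales (exists_C3_rows)
open Summit.QuantumFields.BalabanUV.Beta.D1BFx.RoadEndBFxJunctionsWS (d1Rep_BFx_of_junctions_W_sbpS)

namespace Summit.QuantumFields.BalabanUV.Beta.D1BFx.RoadEndBFxRoadScalesWFlatS

variable {Lc : ℕ} [NeZero Lc] {a N cgh₀ : ℝ} {μ ν : Fin 4}
  {cE cVH cΛ cR cK cQ cE₂ cJ4 cΛ₂ cR₂ cQ₂ x₀ ωgl ωgh cgh : ℕ → ℝ} {WE WJ WΛ WR WQ : ℕ → TableR} {CE CJ CΛt CRt CQ δW : ℕ → ℝ}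
  {TΛ WA : ℕ → Fin 4 → Site 4 → Fin 4 → Site 4 → MKer 4 (Fin 4)} {CT δT : ℕ → ℝ}
  {ε : ℕ → ℝ} {X : ℕ → Site 4 → MKer 4 (Fin 4)} {Cx δx : ℕ → ℝ}

/-- [folklore] **ROAD BF-x ⟹ THE SPINE's `D1Rep`, AT THE ROAD's OBJECTS, ON THE SCALES, FLAT MASS CURRENCY — (C1)(C2)(C3) DISCHARGED, (J3) IN CLOSED FORM,
GENERAL SECOND-ORDER SLOT, NO (J1) ROW (an2 R-D1-g58-1 (A′)).**  PART 21♭'s head with `RJ1 hJ1 {CJ1} hMR₁ hC₁ ↦ W hJ1` (the identity with a displayed `W` slot) and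
`hJ2 ↦` the dictionary booking the road's packed pair PLUS the W-slot carry; everything else VERBATIM PART 21♭. -/
theorem d1Rep_BFx_road_scales_W_flat_sbpS (Js : ℕ → JetData 3 Lc) (hμν : μ ≠ ν) (hN : N ≠ 0) (hL : 2 ≤ Lc) (hodd : Odd Lc)
    (ha : 0 < a)
    (h12 : B5.Prop12Printed (fam nOf hn1 MOf a ha)) (h126 : B5.Kernel126_127Printed (kfam nOf MOf))
    -- bridge B1 REPLACED: composite jet data, the printed symmetries of the flipped step kernels, the spine's `D1Tel`, the one-shot (K)-estimate
    (Jc : ∀ m : ℕ, JetData 3 (Lc ^ m))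
    (hW : ∀ j, WardTransversal (flipK (TbalOf Lc Js j))) (hRfl : ∀ j, AxisReflectionCovariant (flipK (TbalOf Lc Js j)))
    (htel : D1Tel Lc Js Jc)
    -- ===== THE (K) SLOT AT THE ROAD's OBJECTS (PART 10 `PackedRoadHptwScales.hptw_of_junctions`): per-scale block roots, the literal's stencil
    -- ===== families with their STRUCTURAL SOCKETS, torus sequences, per-bond torus pins, LIFTED [P1′]∕[P2′], and the junctions (J1)(J2)(J3)
    -- the block roots, per scale
    (r : ℕ → Fin 4 → ℕ) (hr : ∀ m : ℕ, r (m + 1) ∈ box (3 + 1) (m + 1))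
    -- the literal's first-derivative stencil families, per scale, and their STRUCTURAL SOCKETS
    (S : ℕ → Fin 4 → (Fin 4 → ℤ) → MKer 4 (Fib 3)) {Cs δS : ℕ → ℝ} (hS : ∀ n : ℕ, 2 ≤ n → LocStencil (S n) (Cs n) (δS n))
    (hCs : ∀ n, 0 ≤ Cs n) (hδS : ∀ n, 0 < δS n)
    (hScovB : ∀ n : ℕ, 2 ≤ n → ∀ κ' u t, S n κ' (u + ((n : ℕ) : ℤ) • t) = shiftK (-(((n : ℕ) : ℤ) • t)) (S n κ' u))
    (hSmm : ∀ n : ℕ, 2 ≤ n → ∀ κ' u x y (c b : Fin 4), S n κ' u x y (Sum.inr c) (Sum.inr b) = 0)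
    (hSfm : ∀ n : ℕ, 2 ≤ n → ∀ κ' u x y (c b : Fin 4), S n κ' u x y (Sum.inl c) (Sum.inr b) = S n κ' u y x (Sum.inr b) (Sum.inl c))
    (hSff : ∀ n : ℕ, 2 ≤ n → ∀ κ' u x y (c b : Fin 4), S n κ' u x y (Sum.inl c) (Sum.inl b) = -S n κ' u y x (Sum.inl b) (Sum.inl c))
    -- the literal's second-derivative stencil families, per scale, and their STRUCTURAL SOCKETS
    (S₂ : ℕ → Fin 4 → (Fin 4 → ℤ) → Fin 4 → (Fin 4 → ℤ) → MKer 4 (Fib 3)) {Ck δ₂ : ℕ → ℝ}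
    (hS₂ : ∀ n : ℕ, 2 ≤ n → ∀ κ u κ' u', BiLoc (S₂ n κ u κ' u') u u (Ck n * Real.exp (-δ₂ n * l1 (u' - u))) (δ₂ n))
    (hCk : ∀ n, 0 ≤ Ck n) (hδ₂ : ∀ n, 0 < δ₂ n)
    (hS₂covB : ∀ n : ℕ, 2 ≤ n → ∀ κ' κ'' u u' t, S₂ n κ' (u + ((n : ℕ) : ℤ) • t) κ'' (u' + ((n : ℕ) : ℤ) • t)
      = shiftK (-(((n : ℕ) : ℤ) • t)) (S₂ n κ' u κ'' u'))
    (hS₂mm : ∀ n : ℕ, 2 ≤ n → ∀ κ u κ' u' x y (c b : Fin 4), S₂ n κ u κ' u' x y (Sum.inr c) (Sum.inr b) = 0)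
    (hS₂fm : ∀ n : ℕ, 2 ≤ n → ∀ κ u κ' u' x y (c b : Fin 4),
      S₂ n κ u κ' u' x y (Sum.inl c) (Sum.inr b) = -S₂ n κ u κ' u' y x (Sum.inr b) (Sum.inl c))
    (hS₂ff : ∀ n : ℕ, 2 ≤ n → ∀ κ u κ' u' x y (c b : Fin 4),
      S₂ n κ u κ' u' x y (Sum.inl c) (Sum.inl b) = S₂ n κ u κ' u' y x (Sum.inl b) (Sum.inl c))
    -- the torus sequences, per scale
    (p : ℕ → ℕ → ℕ) [∀ n k, NeZero (p n k)] (hp : ∀ n, Tendsto (p n) atTop atTop)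
    -- the literal's per-bond torus data, per scale, PINNED to the periodised single-bond ∕ pair stencil arrays and THE CONVENTION's generator jets
    (K₁ : ∀ (n : ℕ) [NeZero n] (k : ℕ), I 3 n (p n k) ⊕ J 3 (p n k) → Matrix (I 3 n (p n k)) (I 3 n (p n k)) ℝ)
    (Q₁ : ∀ (n : ℕ) [NeZero n] (k : ℕ), I 3 n (p n k) ⊕ J 3 (p n k) → Matrix (J 3 (p n k)) (I 3 n (p n k)) ℝ)
    (x₁ : ∀ (n : ℕ) [NeZero n] (k : ℕ), I 3 n (p n k) ⊕ J 3 (p n k) → Matrix (I 3 n (p n k)) (CombRows (toSite (r n)) n (p n k)) ℝ)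
    (K₂ : ∀ (n : ℕ) [NeZero n] (k : ℕ), I 3 n (p n k) ⊕ J 3 (p n k) → I 3 n (p n k) ⊕ J 3 (p n k) → Matrix (I 3 n (p n k)) (I 3 n (p n k)) ℝ)
    (Q₂ : ∀ (n : ℕ) [NeZero n] (k : ℕ), I 3 n (p n k) ⊕ J 3 (p n k) → I 3 n (p n k) ⊕ J 3 (p n k) → Matrix (J 3 (p n k)) (I 3 n (p n k)) ℝ)
    (x₂ : ∀ (n : ℕ) [NeZero n] (k : ℕ), I 3 n (p n k) ⊕ J 3 (p n k) → I 3 n (p n k) ⊕ J 3 (p n k) →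
      Matrix (I 3 n (p n k)) (CombRows (toSite (r n)) n (p n k)) ℝ)
    (hK₁ : ∀ n : ℕ, 2 ≤ n → ∀ [NeZero n], ∀ k i, K₁ n k (Sum.inl i) = Matrix.of (periodiseF (p n k) (fTL (sortK n (arr (n * p n k)
      (S n i.2.2 (windowMap 4 (n * p n k) (torusBlockEquiv n (p n k) (i.1, i.2.1)))))))))
    (hQ₁ : ∀ n : ℕ, 2 ≤ n → ∀ [NeZero n], ∀ k i, Q₁ n k (Sum.inl i) = Matrix.of (periodiseF (p n k) (fBL (sortK n (arr (n * p n k)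
      (S n i.2.2 (windowMap 4 (n * p n k) (torusBlockEquiv n (p n k) (i.1, i.2.1)))))))))
    (hx₁ : ∀ n : ℕ, 2 ≤ n → ∀ [NeZero n], ∀ k i, x₁ n k (Sum.inl i) = (Djet (n * p n k) (e₁ n (p n k) i)).submatrix (e₁ n (p n k)) id * Nhat (r n) n (p n k))
    (hK₂ : ∀ n : ℕ, 2 ≤ n → ∀ [NeZero n], ∀ k i j, K₂ n k (Sum.inl i) (Sum.inl j) = Matrix.of (periodiseF (p n k) (fTL (sortK n (fun x y c b => ∑' t : Fin 4 → ℤ,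
      arr (n * p n k) (S₂ n i.2.2 (windowMap 4 (n * p n k) (torusBlockEquiv n (p n k) (i.1, i.2.1))) j.2.2
        (imageShift (n * p n k) (windowMap 4 (n * p n k) (torusBlockEquiv n (p n k) (j.1, j.2.1))) t)) x y c b)))))
    (hQ₂ : ∀ n : ℕ, 2 ≤ n → ∀ [NeZero n], ∀ k i j, Q₂ n k (Sum.inl i) (Sum.inl j) = Matrix.of (periodiseF (p n k) (fBL (sortK n (fun x y c b => ∑' t : Fin 4 → ℤ,
      arr (n * p n k) (S₂ n i.2.2 (windowMap 4 (n * p n k) (torusBlockEquiv n (p n k) (i.1, i.2.1))) j.2.2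
        (imageShift (n * p n k) (windowMap 4 (n * p n k) (torusBlockEquiv n (p n k) (j.1, j.2.1))) t)) x y c b)))))
    (hx₂ : ∀ n : ℕ, 2 ≤ n → ∀ [NeZero n], ∀ k i j, x₂ n k (Sum.inl i) (Sum.inl j) = if i = j then x₁ n k (Sum.inl i) else 0)
    (hK₁0 : ∀ n : ℕ, 2 ≤ n → ∀ [NeZero n], ∀ k j, K₁ n k (Sum.inr j) = 0) (hQ₁0 : ∀ n : ℕ, 2 ≤ n → ∀ [NeZero n], ∀ k j, Q₁ n k (Sum.inr j) = 0)
    (hx₁0 : ∀ n : ℕ, 2 ≤ n → ∀ [NeZero n], ∀ k j, x₁ n k (Sum.inr j) = 0)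
    (hK₂0 : ∀ n : ℕ, 2 ≤ n → ∀ [NeZero n], ∀ k j q, K₂ n k (Sum.inr j) q = 0) (hK₂0' : ∀ n : ℕ, 2 ≤ n → ∀ [NeZero n], ∀ k q j, K₂ n k q (Sum.inr j) = 0)
    (hQ₂0 : ∀ n : ℕ, 2 ≤ n → ∀ [NeZero n], ∀ k j q, Q₂ n k (Sum.inr j) q = 0) (hQ₂0' : ∀ n : ℕ, 2 ≤ n → ∀ [NeZero n], ∀ k q j, Q₂ n k q (Sum.inr j) = 0)
    (hx₂0 : ∀ n : ℕ, 2 ≤ n → ∀ [NeZero n], ∀ k j q, x₂ n k (Sum.inr j) q = 0) (hx₂0' : ∀ n : ℕ, 2 ≤ n → ∀ [NeZero n], ∀ k q j, x₂ n k q (Sum.inr j) = 0)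
    -- the literal's LIFTED table-level Ward identities [P1′]∕[P2′] in the `ad e₃` model (ρ-g16-1′), per torus
    (C : Fin 3 → Matrix (Fin 3) (Fin 3) ℝ) (hC : C 2 = c₃)
    (hP1 : ∀ n : ℕ, 2 ≤ n → ∀ [NeZero n], ∀ k, ∀ q : Fin 3 × (I 3 n (p n k) ⊕ J 3 (p n k)),
      (C q.1 ⊗ₖ kkt (K₁ n k q.2) (Q₁ n k q.2))
          * ((1 : Matrix (Fin 3) (Fin 3) ℝ) ⊗ₖ Matrix.fromRows (What0 (r n) n (p n k)) (0 : Matrix (J 3 (p n k)) (CombRows (toSite (r n)) n (p n k)) ℝ))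
      + ((1 : Matrix (Fin 3) (Fin 3) ℝ) ⊗ₖ kkt (Khat (d := 3) n (p n k)) (Qhat (d := 3) n (p n k)))
          * (C q.1 ⊗ₖ Matrix.fromRows (x₁ n k q.2) (0 : Matrix (J 3 (p n k)) (CombRows (toSite (r n)) n (p n k)) ℝ))
      + oslot (fun q' : Fin 3 × (I 3 n (p n k) ⊕ J 3 (p n k)) =>
            C q'.1 ⊗ₖ Matrix.fromRows (x₁ n k q'.2) (0 : Matrix (J 3 (p n k)) (CombRows (toSite (r n)) n (p n k)) ℝ))
          (fun i => ((1 : Matrix (Fin 3) (Fin 3) ℝ) ⊗ₖ kkt (Khat (d := 3) n (p n k)) (Qhat (d := 3) n (p n k))) i q) = 0)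
    (hP2 : ∀ n : ℕ, 2 ≤ n → ∀ [NeZero n], ∀ k, ∀ q q'' : Fin 3 × (I 3 n (p n k) ⊕ J 3 (p n k)),
      ((C q.1 * C q''.1) ⊗ₖ kkt (K₂ n k q.2 q''.2) (Q₂ n k q.2 q''.2))
          * ((1 : Matrix (Fin 3) (Fin 3) ℝ) ⊗ₖ Matrix.fromRows (What0 (r n) n (p n k)) (0 : Matrix (J 3 (p n k)) (CombRows (toSite (r n)) n (p n k)) ℝ))
      + (C q.1 ⊗ₖ kkt (K₁ n k q.2) (Q₁ n k q.2))
          * (C q''.1 ⊗ₖ Matrix.fromRows (x₁ n k q''.2) (0 : Matrix (J 3 (p n k)) (CombRows (toSite (r n)) n (p n k)) ℝ))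
      + (C q''.1 ⊗ₖ kkt (K₁ n k q''.2) (Q₁ n k q''.2))
          * (C q.1 ⊗ₖ Matrix.fromRows (x₁ n k q.2) (0 : Matrix (J 3 (p n k)) (CombRows (toSite (r n)) n (p n k)) ℝ))
      + ((1 : Matrix (Fin 3) (Fin 3) ℝ) ⊗ₖ kkt (Khat (d := 3) n (p n k)) (Qhat (d := 3) n (p n k)))
          * ((C q.1 * C q''.1) ⊗ₖ Matrix.fromRows (x₂ n k q.2 q''.2) (0 : Matrix (J 3 (p n k)) (CombRows (toSite (r n)) n (p n k)) ℝ))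
      + oslot (fun q' : Fin 3 × (I 3 n (p n k) ⊕ J 3 (p n k)) =>
            C q'.1 ⊗ₖ Matrix.fromRows (x₁ n k q'.2) (0 : Matrix (J 3 (p n k)) (CombRows (toSite (r n)) n (p n k)) ℝ))
          (fun i => (C q''.1 ⊗ₖ kkt (K₁ n k q''.2) (Q₁ n k q''.2)) i q)
      + oslot (fun q' : Fin 3 × (I 3 n (p n k) ⊕ J 3 (p n k)) =>
            (C q''.1 * C q'.1) ⊗ₖ Matrix.fromRows (x₂ n k q''.2 q'.2) (0 : Matrix (J 3 (p n k)) (CombRows (toSite (r n)) n (p n k)) ℝ))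
          (fun i => ((1 : Matrix (Fin 3) (Fin 3) ℝ) ⊗ₖ kkt (Khat (d := 3) n (p n k)) (Qhat (d := 3) n (p n k))) i q)
      + oslot (fun p' : Fin 3 × (I 3 n (p n k) ⊕ J 3 (p n k)) =>
            (C q.1 * C p'.1) ⊗ₖ Matrix.fromRows (x₂ n k q.2 p'.2) (0 : Matrix (J 3 (p n k)) (CombRows (toSite (r n)) n (p n k)) ℝ))
          (fun i => ((1 : Matrix (Fin 3) (Fin 3) ℝ) ⊗ₖ kkt (Khat (d := 3) n (p n k)) (Qhat (d := 3) n (p n k))) i q'') = 0)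
    -- (J1) WITH A GENERAL SECOND-ORDER SLOT, NO REST, NO ROW (PART 20″∕22″; an2 R-D1-g58-1 (A′) «`RJ1 :≡ 0`; the W slot read IN FULL»): the spine's one-shot
    -- kernel at scale `Lc^m` IS the road's Hessian kernel at `G₀ (Lc^m)` with the road's first-order slot and a DISPLAYED second-order family `W (Lc^m)`
    -- (at the literal of record: (J1-γ) ABSORPTION `RoadJ1Absorption.TshotOf_JcOfTabs_eq_hessKer_bm` with `S`, `W` the dressed literal's own jets — PART 22″-lit)
    (W : ℕ → Fin 4 → Site 4 → Fin 4 → Site 4 → MKer 4 (Fib 3))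
    (hJ1 : ∀ m : ℕ, 1 ≤ m → ∀ z : Site 4, TshotOf Lc Jc m μ ν z
      = hessKer (coDressKBmAt (toSite (r (Lc ^ m))) (Lc ^ m) (KInvStep (d := 3) (Lc ^ m) 0))
          (vertexOfK (coDressKBmAt (toSite (r (Lc ^ m))) (Lc ^ m) (KInvStep (d := 3) (Lc ^ m) 0)) (Lc ^ m) (S (Lc ^ m))) (W (Lc ^ m)) μ ν z)
    -- (J2)-W: the (A2-N) TABLE dictionary AT THE END's LETTERS, per scale, BOOKING THE ROAD's PACKED PAIR **PLUS THE W-SLOT CARRY**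
    -- `½·tadpole (G₀ n) (W n μ 0 ν z) − ½·tadpole (G₀ n) (vertex2OfK (G₀ n) n (S₂ n) μ 0 ν z)` (the literal's second-order words beyond the road's pair slot —
    -- SPEC (J2)″ v1.1 §3: W2″a's two mixed words + the chain word (a typed zero, W2″b) + the pair slot's chart word; NOTE (an2 W-5): the carry's
    -- `vertex2OfK (G₀ n) n (S₂ n)` term and the packed pair's `ffW (W2NInf … (S₂ n))` are the SAME pair slot in two currencies (kernel ∕ packed) — the pair
    -- is booked ONCE: the carry subtracts the kernel form that the packed form re-expresses up to PART 10's rest words), with a rest KERNEL `RJ2 n` (displayed; rows below)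
    (RJ2 : ℕ → Fin 4 → Fin 4 → Site 4 → ℝ)
    (hJ2 : ∀ n : ℕ, 2 ≤ n → ∀ [NeZero n], ∀ z : Site 4,
      ((2 : ℝ)⁻¹) ^ 2 * TOfLeg n (Ga n a) (fun κ u => blk (coProjBmAtK (toSite (r n)) n (SN (n - 1) a (S n)) κ u) true true)
            (fun μ' y ν' y' => ((2 : ℝ)⁻¹)⁻¹ • ffW (W2NInf (n - 1) a (r n) (S₂ n)) μ' y ν' y') μ ν z
        + ((1 / 2) * tadpole (coDressKBmAt (toSite (r n)) n (KInvStep (d := 3) n 0)) (W n μ 0 ν z)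
          - (1 / 2) * tadpole (coDressKBmAt (toSite (r n)) n (KInvStep (d := 3) n 0))
              (vertex2OfK (coDressKBmAt (toSite (r n)) n (KInvStep (d := 3) n 0)) n (S₂ n) μ 0 ν z))
      = ωgl n * TOfRed n a (SbfBal n a (cE n) (cVH n) (cΛ n) (cR n) (cK n) (cQ n))
          (tableRed n (Wbf (cE₂ n) (cJ4 n) (cΛ₂ n) (cR₂ n) (cQ₂ n) (WE n) (WJ n) (WΛ n) (WR n) (WQ n))) μ ν z + RJ2 n μ ν z)
    -- (J3): NO HYPOTHESIS — the junction holds with an explicit rest (`GhostDeficitFormula.J3_closed_form`); its rows are displayed below as (C3) + the GAP ROW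
    -- ===== THE LANES' INPUTS ON THE SCALES after (C1): the (L1) FLOOR of the literal's first-stencil rate `hδS₀ hδS₀₂` and units inequality `huS`
    -- ===== (the rate `σV` of PART 14 is CHOSEN INSIDE, its (C1) letter `hTs hTm` is leaf-03 g25's `exists_C1_letters`), the (L2) floor ∕ units
    -- ===== `hδ₂₀ hδ₂₀₂ huT`, the co-frame table rate `κc` and the DISPLAYED co-frame table letter (C2) on the scales (`hCs' hCm`); the comb-FP lane AND
    -- ===== the ghost lane take NO letter; the (J2) rest's rows below
    {σS δ₂₀ σP : ℝ} {mS : ℝ} {mB mP : Bool → Bool → ℝ}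
    (hσS : 0 < σS)
    (hSs : ∀ (k : ℕ), 1 ≤ k → ∀ (κ : Fin 4) (u : Fin 4 → ℤ), Summable fun p : Site 4 × Site 4 =>
      ∑ g, ∑ f, |blk (S (Lc ^ k) κ u) true true p.1 p.2 g f| * Real.exp (σS / ((Lc ^ k : ℕ) : ℝ) * (l1 (p.1 - u) + l1 (p.2 - u))))
    (hSm : ∀ (k : ℕ), 1 ≤ k → ∀ (κ : Fin 4) (u : Fin 4 → ℤ), ∑' p : Site 4 × Site 4,
      ∑ g, ∑ f, |blk (S (Lc ^ k) κ u) true true p.1 p.2 g f| * Real.exp (σS / ((Lc ^ k : ℕ) : ℝ) * (l1 (p.1 - u) + l1 (p.2 - u))) ≤ mS)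
    (hσP : 0 < σP)
    (hPs : ∀ (k : ℕ), 1 ≤ k → ∀ (ρ : Fin 4) (y : Site 4) (j k' : Bool), j ≠ k' → Summable fun p : Site 4 × Site 4 => ∑ g, ∑ f,
      |blk (vertexOfK (coDressKBmAt (toSite (r (Lc ^ k))) (Lc ^ k) (KInvStep (d := 3) (Lc ^ k) 0)) (Lc ^ k) (S (Lc ^ k)) ρ y) j k' p.1 p.2 g f|
        * Real.exp (σP / ((Lc ^ k : ℕ) : ℝ) * (l1 (p.1 - ((Lc ^ k : ℕ) : ℤ) • y) + l1 (p.2 - ((Lc ^ k : ℕ) : ℤ) • y))))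
    (hPm : ∀ (k : ℕ), 1 ≤ k → ∀ (ρ : Fin 4) (y : Site 4) (j k' : Bool), j ≠ k' → ∑' p : Site 4 × Site 4, ∑ g, ∑ f,
      |blk (vertexOfK (coDressKBmAt (toSite (r (Lc ^ k))) (Lc ^ k) (KInvStep (d := 3) (Lc ^ k) 0)) (Lc ^ k) (S (Lc ^ k)) ρ y) j k' p.1 p.2 g f|
        * Real.exp (σP / ((Lc ^ k : ℕ) : ℝ) * (l1 (p.1 - ((Lc ^ k : ℕ) : ℤ) • y) + l1 (p.2 - ((Lc ^ k : ℕ) : ℤ) • y))) ≤ mP j k')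
    (hδ₂₀ : 0 < δ₂₀)
    (hBs : ∀ (k : ℕ), 1 ≤ k → ∀ (κ : Fin 4) (u : Fin 4 → ℤ) (κ' : Fin 4) (u' : Fin 4 → ℤ) (j i : Bool),
      Summable fun p : Site 4 × Site 4 => ∑ g, ∑ f, |blk (S₂ (Lc ^ k) κ u κ' u') j i p.1 p.2 g f|)
    (hBm : ∀ (k : ℕ), 1 ≤ k → ∀ (κ : Fin 4) (u : Fin 4 → ℤ) (κ' : Fin 4) (u' : Fin 4 → ℤ) (j i : Bool),
      ∑' p : Site 4 × Site 4, ∑ g, ∑ f, |blk (S₂ (Lc ^ k) κ u κ' u') j i p.1 p.2 g f|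
        ≤ mB j i * Real.exp (-(δ₂₀ / ((Lc ^ k : ℕ) : ℝ)) * l1 (u' - u)))
    -- (C2): NO HYPOTHESIS — leaf-03 g25's `CoframeTableMassScales.exists_C2_letters` (gan24-leaf-05 g54's δ4b) supplies `κc mC hκc hCs' hCm` inside
    {CJ2 : ℝ}
    (hMR₂ : ∀ m : ℕ, 1 ≤ m → AbsMoment₂ (RJ2 (Lc ^ m) μ ν)) (hC₂ : ∀ m : ℕ, 1 ≤ m → |B12Beta.secondMoment (RJ2 (Lc ^ m)) μ ν| ≤ CJ2)
    -- (C3): NO HYPOTHESIS — gan24-leaf-05 g55's `GhostQWordsScales.exists_C3_rows` (ε3) supplies the four `Q′`-words' rows `CB hMRB hCB` inside (as PART 19)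
    {Cgap : ℝ}
    -- THE GHOST NORMALISATION GAP ROW (F-g20-1): the END's expected ghost main term minus the road's, `(4N²n⁸ − 2)·PghQ(unit ray)`, must have
    -- `m`-uniformly bounded (1.22) second moment — `= (4N² − 2n⁻⁸)·(the uniform base-point average of the punctured full sums of the unit-ray fine ghost
    -- Hessian)` by `AssemblySlots.hF_PghQ_ray`; displayed, NOT asserted
    (hGap : ∀ m : ℕ, 1 ≤ m → |(4 * N ^ 2 * ((Lc ^ m : ℕ) : ℝ) ^ 8 - 2)
        * B12Beta.secondMoment (fun (c e : Fin 4) (z : Site 4) => PghQ (Lc ^ m) a (-1) (((Lc ^ m : ℕ) : ℝ) ^ 2) a c e z) μ ν| ≤ Cgap)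
    -- the RESCALED loop-weight tie of reading (ii): displayed scalar family `s`, pinned `s n = n⁻²`; the normalisation
    (s : ℕ → ℝ) (hs : ∀ n : ℕ, 2 ≤ n → s n = ((n : ℝ) ^ 2)⁻¹) (hωs : ∀ n : ℕ, 2 ≤ n → ωgh n * (s n * cK n) ^ 2 = -2 * (ωgl n * cE n ^ 2))
    (hlam : ∀ n : ℕ, 2 ≤ n → ωgl n * cE n ^ 2 = 2 * N ^ 2 * (n : ℝ) ^ 8)
    -- pins and the ray (the rows' letters)
    (hcE : ∀ n : ℕ, 2 ≤ n → cE n = (n : ℝ) ^ 4) (hRsgn : ∀ n : ℕ, 2 ≤ n → cR n = -cE n) (hJ4 : ∀ n : ℕ, cJ4 n = 0)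
    (hcgh : ∀ n : ℕ, |cgh n| ≤ cgh₀) (hKray : ∀ n : ℕ, cK n = cgh n * (n : ℝ) ^ 2) (hQray : ∀ n : ℕ, cQ n = cgh n * a) (hx : ∀ n : ℕ, x₀ n = -cgh n)
    -- slot-table sockets (the END's), covariance, bond swap; `hdiv` (the ghost Ward rows `hrowgh` are a THEOREM on the ray: discharged inside)
    (hδW : ∀ n, 0 < δW n)
    (hE : ∀ n κ u l u', BiLoc (WE n κ u l u') u u' (CE n) (δW n)) (hJ : ∀ n κ u l u', BiLoc (WJ n κ u l u') u u' (CJ n) (δW n))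
    (hΛ : ∀ n κ u l u', BiLoc (WΛ n κ u l u') u u' (CΛt n) (δW n)) (hR : ∀ n κ u l u', BiLoc (WR n κ u l u') u u' (CRt n) (δW n))
    (hQ : ∀ n κ u l u', BiLoc (WQ n κ u l u') u u' (CQ n) (δW n))
    (hEc : ∀ (n : ℕ) (κ : Fin 4) (u : Site 4) (l : Fin 4) (u' t : Site 4),
      WE n κ (u + (n : ℤ) • t) l (u' + (n : ℤ) • t) = shiftK (-((n : ℤ) • t)) (WE n κ u l u'))
    (hJc : ∀ (n : ℕ) (κ : Fin 4) (u : Site 4) (l : Fin 4) (u' t : Site 4),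
      WJ n κ (u + (n : ℤ) • t) l (u' + (n : ℤ) • t) = shiftK (-((n : ℤ) • t)) (WJ n κ u l u'))
    (hΛc : ∀ (n : ℕ) (κ : Fin 4) (u : Site 4) (l : Fin 4) (u' t : Site 4),
      WΛ n κ (u + (n : ℤ) • t) l (u' + (n : ℤ) • t) = shiftK (-((n : ℤ) • t)) (WΛ n κ u l u'))
    (hRc : ∀ (n : ℕ) (κ : Fin 4) (u : Site 4) (l : Fin 4) (u' t : Site 4),
      WR n κ (u + (n : ℤ) • t) l (u' + (n : ℤ) • t) = shiftK (-((n : ℤ) • t)) (WR n κ u l u'))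
    (hQc : ∀ (n : ℕ) (κ : Fin 4) (u : Site 4) (l : Fin 4) (u' t : Site 4),
      WQ n κ (u + (n : ℤ) • t) l (u' + (n : ℤ) • t) = shiftK (-((n : ℤ) • t)) (WQ n κ u l u'))
    (hEs : ∀ n κ u l u', WE n κ u l u' = WE n l u' κ u) (hJs : ∀ n κ u l u', WJ n κ u l u' = WJ n l u' κ u)
    (hΛs : ∀ n κ u l u', WΛ n κ u l u' = WΛ n l u' κ u) (hRs : ∀ n κ u l u', WR n κ u l u' = WR n l u' κ u)
    (hQs : ∀ n κ u l u', WQ n κ u l u' = WQ n l u' κ u)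
    (hdiv : ∀ n : ℕ, 2 ≤ n → ∀ [NeZero n], ∀ (l' : Fin 4) (u' u : Site 4), ∑ κ' : Fin 4,
      (fineHess n a (SbfBal n a (cE n) (cVH n) (cΛ n) (cR n) (cK n) (cQ n))
          (Wbf (cE₂ n) (cJ4 n) (cΛ₂ n) (cR₂ n) (cQ₂ n) (WE n) (WJ n) (WΛ n) (WR n) (WQ n)) κ' l' (u - Pi.single κ' 1) u'
        - fineHess n a (SbfBal n a (cE n) (cVH n) (cΛ n) (cR n) (cK n) (cQ n))
          (Wbf (cE₂ n) (cJ4 n) (cΛ₂ n) (cR₂ n) (cQ₂ n) (WE n) (WJ n) (WΛ n) (WR n) (WQ n)) κ' l' u u') = 0)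
    -- (LOCAL) slot-E support and units; slot-R envelope and units (the three local ghost bubbles are SUPPLIED under reading (ii))
    {ρE : ℕ} {δ₀ kE : ℝ} (hδ₀ : 0 < δ₀) (hδE : ∀ n, δ₀ ≤ δW n)
    (hsuppE : ∀ n κ u l u', ρE < supNorm (u - u') → WE n κ u l u' = 0)
    (hkE : ∀ n : ℕ, 2 ≤ n → |ωgl n * cE₂ n| * CE n ≤ kE * (n : ℝ) ^ 8)
    {CwR δR : ℕ → ℝ} {θR δ₀R kR : ℝ} (hθR : 0 < θR) (hδR : ∀ n, 0 < δR n) (hδ₀R : 0 < δ₀R) (hδRge : ∀ n : ℕ, δ₀R / n ≤ δR n) (hCwR : ∀ n, 0 ≤ CwR n)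
    (hWRenv : ∀ n κ u l u', BiLoc (WR n κ u l u') u u' (CwR n * Real.exp (-(θR / n) * supNorm (u - u'))) (δR n))
    (hkR : ∀ n : ℕ, 2 ≤ n → |ωgl n * cR₂ n| * CwR n * (n : ℝ) ^ 6 ≤ kR)
    -- (Λ) sockets and zero-momentum data
    (hδT : ∀ n, 0 < δT n)
    (hdec : ∀ n : ℕ, 2 ≤ n → ∀ [NeZero n], ∀ κ u l u', WΛ n κ u l u' =
      (∑ m : Fin 4, OneStepResolventKernel.wsum (onLat n (fun y => lamCoeffOf (KInv (N := n) (d := 3)) n m y l u'))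
          (fun v => onLat n (fun y => TΛ n m y κ u) v))
      + (∑ m : Fin 4, OneStepResolventKernel.wsum (onLat n (fun y => lamCoeffOf (KInv (N := n) (d := 3)) n m y κ u))
          (fun v => onLat n (fun y => TΛ n m y l u') v))
      + WA n κ u l u')
    (hTloc : ∀ (n : ℕ) m y κ u, BiLoc (TΛ n m y κ u) ((n : ℤ) • y) ((n : ℤ) • y) (CT n * Real.exp (-δT n * l1 ((n : ℤ) • y - u))) (δT n))
    (hWAa : ∀ n κ u l u', trK (WA n κ u l u') = -WA n κ u l u') (hWAl : ∀ n κ u l u', Loc (WA n κ u l u'))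
    (hTcov : ∀ (n : ℕ) m y κ u t, TΛ n m (y + t) κ (u + (n : ℤ) • t) = shiftK (-((n : ℤ) • t)) (TΛ n m y κ u))
    (hcΛ : ∀ n : ℕ, 2 ≤ n → cΛ n ≠ 0) (hε : ∀ n : ℕ, ε n = 1 ∨ ε n = -1) (hδx : ∀ n, 0 < δx n) (hX : ∀ n u, BiLoc (X n u) u u (Cx n) (δx n))
    (hW1 : ∀ n : ℕ, 2 ≤ n → ∀ [NeZero n], ∀ u,
      comp (comp (Ga n a) (divV (fun κ v => ε n • SbfBal n a (cE n) (cVH n) (cΛ n) (cR n) (cK n) (cQ n) κ v) u)) (Ga n a) =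
        comp (Ga n a) (X n u) - comp (X n u) (Ga n a))
    (hW2 : ∀ n : ℕ, 2 ≤ n → ∀ [NeZero n], ∀ (m : Fin 4) (u : Site 4),
      divV (fun κ v => (-(ε n * (cΛ₂ n / cΛ n))) • TΛ n m 0 κ v) u = comp (X n u) (ffOf (hessFF n m 0)) - comp (ffOf (hessFF n m 0)) (X n u))
    -- (N) slot Q's SOCKETS (the (A2) readout of `WQ`: a decaying bi-localisation envelope at a BLOCK-scale rate floor and its units line — T₈ ⟸ `NeedleTadpoleRowDecay`)
    {CwQ δQ : ℕ → ℝ} {θQ δ₀Q kQ : ℝ} (hθQ : 0 < θQ) (hδQ : ∀ n, 0 < δQ n) (hδ₀Q : 0 < δ₀Q) (hδQge : ∀ n : ℕ, δ₀Q / n ≤ δQ n) (hCwQ : ∀ n, 0 ≤ CwQ n)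
    (hWQenv : ∀ n κ u l u', BiLoc (WQ n κ u l u') u u' (CwQ n * Real.exp (-(θQ / n) * supNorm (u - u'))) (δQ n))
    (hkQ : ∀ n : ℕ, 2 ≤ n → |ωgl n * cQ₂ n| * CwQ n * (n : ℝ) ^ 6 ≤ kQ)
    -- base-point labels of the free one-shot side (the spine root's `hSL` ∕ `k`); the Literature's window data is discharged at `M := id`, `cc := 1`
    {L : Type*} {SL : Finset L} (hSL : SL.Nonempty) (k : L → Fin 4) :
    D1Rep Lc Jc N μ ν a SL k := by
  -- (C3) «THE FOUR `Q′`-WORDS' ROWS ON THE SCALES» (gan24-leaf-05 g55 ε3, BY NAME, at the road's own roots)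
  obtain ⟨CB, hC3⟩ := exists_C3_rows (L := Lc) (a := a) hL ha hr
  -- (C2) «TB4-W CO-FRAME TABLE, m-UNIFORM MASS» on the scales (leaf-03 g25 part 6, BY NAME, at the road's own roots)
  obtain ⟨κc, hκc, mC, hC2⟩ := exists_C2_letters (L := Lc) (a := a) hL ha hr μ ν
  -- the per-scale root, for `n ≥ 2`
  have hr2 : ∀ n : ℕ, 2 ≤ n → r n ∈ box (3 + 1) n := fun n hn => by
    obtain ⟨m, rfl⟩ : ∃ m, n = m + 1 := ⟨n - 1, by omega⟩
    exact hr m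
  -- (C1) on the scales (leaf-03 g25 part 5): the window `σ₀(Lc, a)`; the rate chosen inside, below `σ₀`, the [B5] strip constant and the displayed rate `σS`
  obtain ⟨σ₀, hσ₀, hC1⟩ := exists_C1_letters (L := Lc) (a := a) hL ha
  have hκ : 0 < kappa163 4 / 4 / 16 := by have := kappa163_pos 4; positivity
  set σV : ℝ := min (min (min σ₀ (kappa163 4 / 4 / 16)) σS) σP with hσVdef
  have hσV : 0 < σV := lt_min (lt_min (lt_min hσ₀ hκ) hσS) hσP
  have hσVσ₀ : σV ≤ σ₀ := ((min_le_left _ _).trans (min_le_left _ _)).trans (min_le_left _ _)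
  have hσVκ : σV ≤ kappa163 4 / 4 / 16 := ((min_le_left _ _).trans (min_le_left _ _)).trans (min_le_right _ _)
  have hσVσ : σV ≤ σS := (min_le_left _ _).trans (min_le_right _ _)
  have hσVP : σV ≤ σP := min_le_right _ _
  have h2k : ∀ k : ℕ, 1 ≤ k → 2 ≤ Lc ^ k := fun k hk => RoadEndBFxDictPointwiseS.two_le_pow_scale hL hk
  have hSmm' : ∀ (k : ℕ), 1 ≤ k → ∀ (κ : Fin 4) (u : Fin 4 → ℤ), blk (S (Lc ^ k) κ u) false false = 0 := fun k hk κ u => by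
    funext x y g f
    exact hSmm (Lc ^ k) (h2k k hk) κ u x y g f
  obtain ⟨mT, hT⟩ := hC1 σV hσV.le hσVσ₀
  -- PART 14's body with the MASS façade: the lanes' rows on the subsequence from (L1-M)(L2-M) + (C1)(C2)
  obtain ⟨kG, K, c, -, -, -, hMRs, hRus⟩ := road_sand_rows_mass_tt (Lc := Lc) (S := S) (S₂ := S₂) (μ := μ) (ν := ν) ha hL h12 h126 hr hSs hSm hσV hσVκ
    hσVσ (fun k hk κ u => (hT k hk κ u).1) (fun k hk κ u => (hT k hk κ u).2) hS₂ hCk hδ₂ hδ₂₀ hBs hBm hκc (fun k hk z j i => (hC2 k hk z j i).1)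
    (fun k hk z j i => (hC2 k hk z j i).2)
  obtain ⟨kG', K', c', -, -, -, hMRb, hRub⟩ := road_blk_rows_mass_flat (Lc := Lc) (S := S) (S₂ := S₂) (μ := μ) (ν := ν) ha hL h12 h126 hr hSs hSm hSmm'
    hσV hσVκ hσVσ (fun k hk κ u => (hT k hk κ u).1) (fun k hk κ u => (hT k hk κ u).2) hσVP hPs hPm hS₂ hCk hδ₂ hδ₂₀ hBs hBm hκc
    (fun k hk z j i => (hC2 k hk z j i).1) (fun k hk z j i => (hC2 k hk z j i).2)
  obtain ⟨hMRf, hRuf, -, -, -⟩ := END_rows_RkFP_road (Lc := Lc) (𝓻 := r) (μ := μ) (ν := ν) hr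
  rw [← wroad_eq_dite] at hMRf hRuf
  obtain ⟨hMRg, hRug, -, -, -⟩ := END_rows_RkGhJ (Lc := Lc) (ω := fun _ => (1 : ℝ)) (a := a) (𝒱 := Vgh r) (𝒲 := Wgh r) (μ := μ) (ν := ν) (Ω := 1)
    (fun _ => by rw [abs_one]) (kappaG_road_pos ha) (fun _ => KG_road_nonneg ha) (fun m i => decay510_ghostWordK_road m (hr m) ha i μ ν)
  have hMR2 : ∀ (u : Unit) (m : ℕ), 1 ≤ m → AbsMoment₂ ((fun _ : Unit => RJ2) u (Lc ^ m) μ ν) := fun _ m hm => hMR₂ m hm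
  have hRu2 : ∀ (u : Unit) (m : ℕ), 1 ≤ m →
      |B12Beta.secondMoment ((fun _ : Unit => RJ2) u (Lc ^ m)) μ ν - (fun (_ : Unit) (_ : ℕ) => (0 : ℝ)) u (Lc ^ m)| ≤ (fun _ : Unit => CJ2) u :=
    fun _ m hm => by simpa using hC₂ m hm
  -- the explicit (J3) rest `(4N²n⁸ − 2)·PghQ(unit ray) + 2·BR n` (PART 16) and its rows from the GAP ROW and the (C3) row
  set R3 : ℕ → Fin 4 → Fin 4 → Site 4 → ℝ :=
      (fun n c e z => if hn0 : n = 0 then (0 : ℝ) else (haveI : NeZero n := ⟨hn0⟩;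
        (4 * N ^ 2 * (n : ℝ) ^ 8 - 2) * PghQ n a (-1) ((n : ℝ) ^ 2) a c e z + 2 *
        ((1 / 2) * tadpole (Ggh n a) (∑ κ : Fin 4, ∑ l : Fin 4, wsum (colH (coDressKBmAt (toSite (r n)) n (KInvStep (d := 3) n 0)) n c 0 κ)
              (fun u => wsum (colH (coDressKBmAt (toSite (r n)) n (KInvStep (d := 3) n 0)) n e z l)
                (fun v' => (-((-1) * a * ((n : ℕ) : ℝ) ^ 4)) • qSqAt (ctrHalf n) n κ u l v')))
          - (1 / 2) * (bubble (Ggh n a)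
                (∑ κ : Fin 4, wsum (colH (coDressKBmAt (toSite (r n)) n (KInvStep (d := 3) n 0)) n c 0 κ) (fun u => (((n : ℕ) : ℝ) ^ 2) • ghCur κ u))
                (∑ κ : Fin 4, wsum (colH (coDressKBmAt (toSite (r n)) n (KInvStep (d := 3) n 0)) n e z κ) (fun u => a • qAntiAt (ctrHalf n) n κ u))
              + bubble (Ggh n a)
                (∑ κ : Fin 4, wsum (colH (coDressKBmAt (toSite (r n)) n (KInvStep (d := 3) n 0)) n c 0 κ) (fun u => a • qAntiAt (ctrHalf n) n κ u))
                (∑ κ : Fin 4, wsum (colH (coDressKBmAt (toSite (r n)) n (KInvStep (d := 3) n 0)) n e z κ) (fun u => (((n : ℕ) : ℝ) ^ 2) • ghCur κ u))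
              + bubble (Ggh n a)
                (∑ κ : Fin 4, wsum (colH (coDressKBmAt (toSite (r n)) n (KInvStep (d := 3) n 0)) n c 0 κ) (fun u => a • qAntiAt (ctrHalf n) n κ u))
                (∑ κ : Fin 4, wsum (colH (coDressKBmAt (toSite (r n)) n (KInvStep (d := 3) n 0)) n e z κ) (fun u => a • qAntiAt (ctrHalf n) n κ u))))))
    with hR3
  have hJ3 : ∀ n : ℕ, 2 ≤ n → ∀ [NeZero n], ∀ z : Site 4,
      -(2 * hessKer (Ggh n a)
          (fun κ' v => (((n : ℕ) : ℝ) ^ 2) • (fun x y a b => ∑ κ : Fin 4,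
            wsum (colH (coDressKBmAt (toSite (r n)) n (KInvStep (d := 3) n 0)) n κ' v κ) (ghCur κ) x y a b))
          (fun κ' v l v' => (((n : ℕ) : ℝ) ^ 2) • (fun x y a b => ∑ κ : Fin 4,
            wsum (colH (coDressKBmAt (toSite (r n)) n (KInvStep (d := 3) n 0)) n κ' v κ)
              (fun u => fun x y a b => colH (coDressKBmAt (toSite (r n)) n (KInvStep (d := 3) n 0)) n l v' κ u * gh₂ κ u x y a b) x y a b)) μ ν z)
      = ωgh n * PghQ n a (x₀ n) (cK n) (cQ n) μ ν z + R3 n μ ν z := by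
    intro n hn _ z
    have h := J3_closed_form (N := N) (cE := cE) (ωgl := ωgl) (ωgh := ωgh) (cgh := cgh) (s := s) n hn (hr2 n hn) ha hs hωs hlam hKray hQray hx μ ν z
    have hn0 : n ≠ 0 := by omega
    simp only [hR3, dif_neg hn0]
    exact h
  have hMR3 : ∀ (u : Unit) (m : ℕ), 1 ≤ m → AbsMoment₂ ((fun _ : Unit => R3) u (Lc ^ m) μ ν) := fun _ m hm => by
    have hne : Lc ^ m ≠ 0 := NeZero.ne _
    simp only [hR3, dif_neg hne]
    exact absMoment₂_lin (absMoment₂_PghQ (Lc ^ m) a (-1) (((Lc ^ m : ℕ) : ℝ) ^ 2) a ha μ ν) ((hC3 m hm).1 μ ν) _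
  have hRu3 : ∀ (u : Unit) (m : ℕ), 1 ≤ m →
      |B12Beta.secondMoment ((fun _ : Unit => R3) u (Lc ^ m)) μ ν - (fun (_ : Unit) (_ : ℕ) => (0 : ℝ)) u (Lc ^ m)| ≤ (fun _ : Unit => Cgap + 2 * CB) u :=
    fun _ m hm => by
    have hne : Lc ^ m ≠ 0 := NeZero.ne _
    simp only [hR3, dif_neg hne, sub_zero]
    exact abs_secondMoment_lin_le (fun c e => absMoment₂_PghQ (Lc ^ m) a (-1) (((Lc ^ m : ℕ) : ℝ) ^ 2) a ha c e)
      (fun c e => (hC3 m hm).1 c e) _ μ ν (hGap m hm) ((hC3 m hm).2 μ ν)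
  exact d1Rep_BFx_of_junctions_W_sbpS (Ru := fun (_ : RoadIdx) (_ : ℕ) => (0 : ℝ)) (CU := fun _ => 0) Js hμν hN hL hodd ha h12 h126 Jc hW hRfl htel r
    (fun n hn _ => hr2 n hn)
    S hS hCs hδS hScovB hSmm hSfm hSff S₂ hS₂ hCk hδ₂ hS₂covB hS₂mm hS₂fm hS₂ff p hp K₁ Q₁ x₁ K₂ Q₂ x₂ hK₁ hQ₁ hx₁ hK₂ hQ₂ hx₂ hK₁0 hQ₁0
    hx₁0 hK₂0 hK₂0' hQ₂0 hQ₂0' hx₂0 hx₂0' C hC hP1 hP2 W hJ1 RJ2 R3 hJ2 hJ3 (RkRoad a r S S₂ RJ2 R3)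
    (fun m _ z => sum_RkRoad_of_neZero a r S S₂ RJ2 R3 (Lc ^ m) μ ν z)
    (hMR_elim hMRs (hMR_elim hMRb (hMR_elim hMRf (hMR_elim hMR2 (hMR_elim hMR3 hMRg)))))
    (hRu_elim_zero hRus (hRu_elim_zero hRub (hRu_elim_zero hRuf (hRu_elim_zero hRu2 (hRu_elim_zero hRu3 hRug)))))
    le_rfl s hs hωs hlam hcE hRsgn hJ4 hcgh hKray hQray hx hδW hE hJ hΛ hR hQ hEc hJc hΛc hRc hQc hEs hJs hΛs hRs hQs hdiv hδ₀ hδE hsuppE hkE hθR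
    hδR hδ₀R hδRge hCwR hWRenv hkR hδT hdec hTloc hWAa hWAl hTcov hcΛ hε hδx hX hW1 hW2 hθQ hδQ hδ₀Q hδQge hCwQ hWQenv hkQ (fun n _ u => by simp) hSL k

end Summit.QuantumFields.BalabanUV.Beta.D1BFx.RoadEndBFxRoadScalesWFlatS

end
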